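import Summits.QuantumAdvantage.AdviceFreeQNC0.WalkCoreBasics
import HarnessLib

/-!
# Cell qa-qnc0 (rung F-Q1, route RingFrame, crux α): walk core — W1, the genuine rows ARE walk
# win patterns of the induced strategy (planner qa-qnc0-p1 Sketch10 §22.2, ask P9)

Statement VERBATIM from `Sketch10.lean` §22.2 (`GenuineRowIsWalk`) and PROVED:

* `ringWinU_eq_trace` — the walk win bit in trace form, `WIN_y(v) = Tr(ω^{c+|v|}·Σ_g y_g(v) ω^{g+|v_{<g}|})`;
* `F1_eq_induced` — Team 1's profile is `ω^{L}` times the (charge-free) profile of the INDUCED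
  strategy `induced y u` on Bob's cube;
* `triple_rot0_eq_trace` — the finite identity `triple r (rot0 m (a ⊕ b, b)) = Tr(ω^{m+r}·(a + bω))`;
* **W1 `genuineRow_isWalk : GenuineRowIsWalk`** — every row of the genuine LDMA instance of label
  `r` is the win pattern of the induced walk strategy at charge `c + L + r`;
* `genuineRow_isWalkRow` — hence each genuine row is an `IsWalkRow (c + L + r) D` row when the
  strategy has degree `≤ D`.

WHAT THIS IS NOT: W2 (`LDMAFam → WalkHardAll`), E2, E6 are not here; nothing on α or the separation.
-/

noncomputable section

namespace Summit.QuantumAdvantage.AdviceFreeQNC0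

open Finset
open Literature.Computability.MetaComplexity Literature.Computability.MetaComplexity.Smolensky

variable {L L' : ℕ}

/-! ### Vocabulary (verbatim from `Sketch10` §22.2) -/

/-- **W1**: every row of the genuine instance of label `r` is the WIN PATTERN OF THE INDUCED WALK
STRATEGY on Bob's cube at charge `c + L + r` (verbatim from `Sketch10` §22.2). -/
def GenuineRowIsWalk : Prop :=
  ∀ L L' c : ℕ, ∀ y : Fin (L + L' + 1) → (Fin (L + L') → Bool) → Bool, ∀ r : Fin 3,
    ∀ u : Fin L → Bool, ∀ v : Fin L' → Bool,
      genuineRow c y r u v = ringWinU (c + L + r.val) (induced y u) v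

/-! ### The walk win bit in trace form -/

/-- the charge-free profile `Σ_g y_g(v)·ω^{g + |v_{<g}|}` of a strategy on `n` bits. -/
def profile {n : ℕ} (y : Fin (n + 1) → (Fin n → Bool) → Bool) (v : Fin n → Bool) : T4 :=
  t4sum univ fun g : Fin (n + 1) =>
    if y g v = true then tOmegaPow (g.val + wtPrefix v g.val) (true, false) else (false, false)

/-- `ω^m · (if b then p else 0) = if b then ω^m p else 0`. -/
private theorem tOmegaPow_ite' (m : ℕ) (b : Bool) (p : T4) :
    tOmegaPow m (if b = true then p else (false, false)) =
      (if b = true then tOmegaPow m p else (false, false)) := by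
  cases b
  · simp [tOmegaPow_zero_elt]
  · simp

/-- **Trace form of the win bit**: `WIN_y(v) = (ω^{c + |v|} · profile y v).2`. -/
theorem ringWinU_eq_trace {n : ℕ} (c : ℕ) (y : Fin (n + 1) → (Fin n → Bool) → Bool)
    (v : Fin n → Bool) : ringWinU c y v = (tOmegaPow (c + wt v) (profile y v)).2 := by
  set T : Fin (n + 1) → T4 := fun g =>
    if y g v = true then tOmegaPow (c + g.val + walkExp v g.val) (true, false) else (false, false)
    with hT
  have h1 : ringWinU c y v = (t4sum univ T).2 := by
    unfold ringWinU
    rw [t4sum_snd]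
    have hset : (univ.filter fun g : Fin (n + 1) =>
          y g v = true ∧ (c + g.val + walkExp v g.val) % 3 ≠ 0) =
        univ.filter fun g : Fin (n + 1) => (T g).2 = true := by
      ext g
      simp only [mem_filter, mem_univ, true_and, hT]
      cases y g v <;> simp [tOmegaPow_one_snd]
    rw [hset]
  have h2 : T = fun g => tOmegaPow (c + wt v)
      (if y g v = true then tOmegaPow (g.val + wtPrefix v g.val) (true, false) else (false, false)) := by
    funext g
    simp only [hT]
    rw [tOmegaPow_ite', ← tOmegaPow_add]
    have he : c + g.val + walkExp v g.val = c + wt v + (g.val + wtPrefix v g.val) := by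
      unfold walkExp; ring
    rw [he]
  rw [h1, h2, t4sum_tOmegaPow]
  rfl

/-! ### Team 1's profile through the induced strategy -/

/-- reindexing a `t4sum` along an embedding. -/
theorem t4sum_map {α β : Type*} (s : Finset α) (e : α ↪ β) (f : β → T4) :
    t4sum (s.map e) f = t4sum s (fun a => f (e a)) := by
  unfold t4sum
  rw [Finset.filter_map, Finset.filter_map, Finset.card_map, Finset.card_map]
  rfl

/-- the embedding of Bob's positions `g' ↦ L + g'`. -/
def shiftEmb (L L' : ℕ) : Fin (L' + 1) ↪ Fin (L + L' + 1) :=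
  ⟨fun g' => ⟨L + g'.val, by omega⟩, fun a b h => by
    have := congrArg Fin.val h
    exact Fin.ext (by simp at this; omega)⟩

/-- Bob's positions are the image of the shift. -/
theorem filter_ge_eq_map (L L' : ℕ) :
    (univ.filter fun g : Fin (L + L' + 1) => ¬ g.val < L) = univ.map (shiftEmb L L') := by
  ext g
  simp only [mem_filter, mem_univ, true_and, mem_map, not_lt]
  constructor
  · intro h
    refine ⟨⟨g.val - L, by omega⟩, ?_⟩
    exact Fin.ext (by simp [shiftEmb]; omega)
  · rintro ⟨g', rfl⟩
    simp [shiftEmb]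

/-- **`F1 y v u = ω^{L} · profile (induced y u) v`.** -/
theorem F1_eq_induced (y : Fin (L + L' + 1) → (Fin (L + L') → Bool) → Bool) (u : Fin L → Bool)
    (v : Fin L' → Bool) : F1 y v u = tOmegaPow L (profile (induced y u) v) := by
  unfold F1 profile
  rw [← t4sum_tOmegaPow, filter_ge_eq_map, t4sum_map]
  refine t4sum_congr _ fun g' _ => ?_
  have hidx : y (shiftEmb L L' g') (Fin.append u v) = induced y u g' v := rfl
  rw [hidx, tOmegaPow_ite', ← tOmegaPow_add]
  have he : ((shiftEmb L L' g' : Fin (L + L' + 1)).val + wtPrefix v ((shiftEmb L L' g').val - L)) =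
      L + (g'.val + wtPrefix v g'.val) := by
    simp [shiftEmb]; ring
  rw [he]

/-! ### The finite identity and W1 -/

/-- `triple r (rot0 m (a ⊕ b, b)) = Tr(ω^{m + r} · (a, b))` on residues (finite check). -/
private theorem triple_rot0_law : ∀ m r : Fin 3, ∀ a b : Bool,
    triple r (rot0 m.val (xor a b) b).1 (rot0 m.val (xor a b) b).2 =
      (tOmegaPow (m.val + r.val) (a, b)).2 := by
  decide

/-- `triple r (rot0 m (a ⊕ b, b)) = Tr(ω^{m + r} · (a, b))`. -/
theorem triple_rot0_eq_trace (m : ℕ) (r : Fin 3) (a b : Bool) :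
    triple r (rot0 m (xor a b) b).1 (rot0 m (xor a b) b).2 = (tOmegaPow (m + r.val) (a, b)).2 := by
  rw [rot0_mod, tOmegaPow_mod, Nat.add_mod,
    ← tOmegaPow_mod (m % 3 + r.val % 3)]
  have hr : r.val % 3 = r.val := Nat.mod_eq_of_lt r.isLt
  rw [hr]
  exact triple_rot0_law ⟨m % 3, Nat.mod_lt _ (by norm_num)⟩ r a b

/-- **W1 `GenuineRowIsWalk`.** -/
theorem genuineRow_isWalk : GenuineRowIsWalk := by
  intro L L' c y r u v
  rw [ringWinU_eq_trace, show c + L + r.val + wt v = (c + wt v + r.val) + L by ring, tOmegaPow_add,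
    ← F1_eq_induced]
  unfold genuineRow stakes1
  exact triple_rot0_eq_trace (c + wt v) r (F1 y v u).1 (F1 y v u).2

/-- Hence every genuine row is a walk row of the induced strategy's degree. -/
theorem genuineRow_isWalkRow {D : ℕ} (c : ℕ) (y : Fin (L + L' + 1) → (Fin (L + L') → Bool) → Bool)
    (hy : ∀ g, HasDeg (y g) D) (r : Fin 3) (u : Fin L → Bool) :
    IsWalkRow (c + L + r.val) D (genuineRow c y r u) :=
  ⟨induced y u, fun g' => hasDeg_induced y hy u g', fun v => genuineRow_isWalk L L' c y r u v⟩

end Summit.QuantumAdvantage.AdviceFreeQNC0
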